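import Literature.Probability.RandomPlanarGeometry.SAWEndpointPieceInsertionZd
import HarnessLib

/-!
# Inserting or appending a half-space piece: `c_n · #pieces ≤ (4d² n + 2d) · c_{n+m+1}` for ALL walks (`ℤ^d`)

Topic `Literature/Probability/RandomPlanarGeometry` (continues `SAWEndpointPieceInsertionZd.lean`: the core classes
`PieceInsertionZd.Core`, the splice, `PieceInsertionZd.splice_mem_sawFun`; `SAWCount.lean`: `Zd.saws`, `Zd.count`).

Source: N. Madras, G. Slade, *The Self-Avoiding Walk* (1993), Lemma 7.3.3 (proof, p. 247: the first time `j` of maximal norm,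
the outer normal, the free half-space) and §7.5, eq. (7.5.1) (Kesten 1963: the exponent `1/3` needs a super-multiplicativity
input at a SHORT length).  For the family of ALL `n`-step walks the endpoint is free, so the insertion of
`SAWEndpointPieceInsertionZd.lean` is complemented by an APPEND step: at the first time `j ≥ 1` the walk is farthest in the
direction `s e_k` of its first step… more precisely of a coordinate record, either `j < n` (insert a piece between `ω(j)` and
`ω(j+1)`, a core class) or `j = n` (the endpoint is the record: append `ω(n) + s e_k` and then the piece — a tail class).

## Main statements (namespace `Literature.Probability.RandomPlanarGeometry.SAW.Zd.PieceInsertionZd`)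

* `Tail n k s`, `appendP`, `appendP_mem_saws` — the tail classes and the append map;
* `card_core_saws_mul_le`, `card_tail_mul_le` — class × pieces injects into `(n+m+1)`-step walks;
* `exists_core_or_tail` — every `n`-step walk (`n ≥ 1`) lies in a core class or a tail class;
* **`count_mul_le`** — if `L ≤ #pieces m k s (t e_{k'})` for all orientations, then `c_n · L ≤ (4 d² n + 2 d) · c_{n+m+1}`.
-/

noncomputable section

open Finset Literature.Probability.LatticeModels SimpleGraph

namespace Literature.Probability.RandomPlanarGeometry.SAW.Zd

namespace PieceInsertionZd

variable {d : ℕ}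

/-! ### Tail classes and the append map -/

/-- The tail class: the endpoint `ω(n)` is extremal in direction `s e_k`. [cite: MadrasSlade1993, Lemma 7.3.3 (proof: the time of maximal norm)] -/
def Tail (n : ℕ) (k : Fin d) (s : ℤ) (ω : ℕ → Site d) : Prop := ∀ i ≤ n, s * ω i k ≤ s * ω n k

/-- Append `v` and then the translated piece after time `n`. [cite: MadrasSlade1993, Corollary 3.2.6 (proof: concatenation)] -/
def appendP (n : ℕ) (v : Site d) (ω η : ℕ → Site d) : ℕ → Site d := fun i =>
  if i ≤ n then ω i else ω n + v + η (i - (n + 1))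

/-- Left inverse of the append map on the walk. [folklore] -/
def unappendW (n : ℕ) (ω' : ℕ → Site d) : ℕ → Site d := fun i => ω' (min i n)

variable {n m : ℕ} {v w : Site d} {ω η : ℕ → Site d} {k : Fin d} {s : ℤ}

/-- Values of the append map up to time `n`. [folklore] -/
private theorem appendP_of_le {i : ℕ} (h : i ≤ n) : appendP n v ω η i = ω i := by simp [appendP, h]

/-- Values of the append map after time `n`. [folklore] -/
private theorem appendP_of_gt {i : ℕ} (h : n + 1 ≤ i) : appendP n v ω η i = ω n + v + η (i - (n + 1)) := by
  simp [appendP, show ¬ i ≤ n by omega]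

/-- `unappendW` inverts the append map on walks frozen after time `n`. [folklore] -/
private theorem unappendW_appendP (hω : ω ∈ saws d n) : unappendW n (appendP n v ω η) = ω := by
  obtain ⟨-, hend, -, -⟩ := mem_saws.1 hω
  funext i
  rcases le_or_gt i n with h | h
  · simp [unappendW, min_eq_left h, appendP_of_le h]
  · simp only [unappendW, min_eq_right h.le, appendP_of_le le_rfl]
    exact (hend i h.le).symm

/-- `unspliceP n m` inverts the append map on pieces. [folklore] -/
private theorem unspliceP_appendP (hη : η ∈ sawFun d m w) : unspliceP n m (appendP n v ω η) = η := by
  obtain ⟨h0, hend, -, -⟩ := mem_sawFun.1 hη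
  funext i
  simp only [unspliceP]
  rw [appendP_of_gt (by omega), appendP_of_gt le_rfl, Nat.sub_self, h0, add_zero,
    show n + 1 + min i m - (n + 1) = min i m by omega, add_sub_cancel_left]
  rcases le_or_gt i m with h | h
  · rw [min_eq_left h]
  · rw [min_eq_right h.le, hend i h.le, hend m le_rfl]

/-- `s² = 1` for a sign. [folklore] -/
private theorem sq_sign' (hs : s = 1 ∨ s = -1) : s * s = 1 := by
  rcases hs with rfl | rfl <;> norm_num

/-- `0 ~ s e_k` for a sign `s`. [folklore] -/
private theorem adj_zero_single' (hs : s = 1 ∨ s = -1) : (zdGraph d).Adj (0 : Site d) (Pi.single k s) := by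
  rw [zdGraph_adj_iff]
  rcases hs with rfl | rfl
  · exact ⟨k, Or.inl (by simp)⟩
  · exact ⟨k, Or.inr (by rw [← Pi.single_add]; simp)⟩

/-- **The appended walk is an `(n+m+1)`-step self-avoiding walk** (endpoint free).
[cite: MadrasSlade1993, Lemma 7.3.3 (proof: "the added points have larger norm than any other points"), Corollary 3.2.6 (proof)] -/
theorem appendP_mem_saws (hs : s = 1 ∨ s = -1) (htail : Tail n k s ω) (hω : ω ∈ saws d n)
    (hη : η ∈ pieces m k s w) : appendP n (Pi.single k s) ω η ∈ saws d (n + m + 1) := by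
  obtain ⟨h0, hend, hadj, hinj⟩ := mem_saws.1 hω
  obtain ⟨hηs, hcons⟩ := mem_pieces.1 hη
  obtain ⟨hη0, hηend, hηadj, hηinj⟩ := mem_sawFun.1 hηs
  set v : Site d := Pi.single k s with hv
  have hss := sq_sign' hs
  -- freshness of the appended points
  have hF : ∀ {a b : ℕ}, a ≤ m → b ≤ n → ω n + v + η a ≠ ω b := by
    intro a b ha hb h
    have h1 := hcons a ha
    have h2 := htail b hb
    have h3 := congrArg (fun y : Site d => s * y k) h
    simp only [Pi.add_apply, hv, Pi.single_eq_same, mul_add] at h3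
    linarith
  refine mem_saws.2 ⟨by rw [appendP_of_le (Nat.zero_le _), h0], fun i hi => ?_, fun i hi => ?_, ?_⟩
  · rw [appendP_of_gt (by omega), appendP_of_gt (by omega), hηend _ (by omega), hηend _ (by omega)]
  · rcases Nat.lt_or_ge i n with h | h
    · rw [appendP_of_le h.le, appendP_of_le (by omega : i + 1 ≤ n)]; exact hadj i h
    rcases h.eq_or_lt with h | h
    · rw [← h, appendP_of_le le_rfl, appendP_of_gt le_rfl, Nat.sub_self, hη0, add_zero]
      have := (zdGraph_adj_add_right 0 v (ω n)).2 (adj_zero_single' (k := k) hs)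
      simpa [add_comm] using this
    · rw [appendP_of_gt (by omega), appendP_of_gt (by omega),
        show i + 1 - (n + 1) = i - (n + 1) + 1 by omega, add_comm (ω n + v), add_comm (ω n + v), zdGraph_adj_add_right]
      exact hηadj _ (by omega)
  · intro a ha b hb hab
    simp only [Set.mem_setOf_eq] at ha hb
    rcases le_or_gt a n with h1 | h1 <;> rcases le_or_gt b n with h2 | h2
    · rw [appendP_of_le h1, appendP_of_le h2] at hab; exact hinj h1 h2 hab
    · rw [appendP_of_le h1, appendP_of_gt (by omega)] at hab; exact absurd hab.symm (hF (by omega) h1)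
    · rw [appendP_of_gt (by omega), appendP_of_le h2] at hab; exact absurd hab (hF (by omega) h2)
    · rw [appendP_of_gt (by omega), appendP_of_gt (by omega)] at hab
      have := hηinj (show a - (n + 1) ≤ m by omega) (show b - (n + 1) ≤ m by omega) (add_left_cancel hab)
      omega

/-! ### Class bounds on all walks -/

/-- `unspliceW` inverts the splice (copy of the planar file's plumbing). [folklore] -/
private theorem unspliceW_splice' {j : ℕ} : unspliceW j m (splice j m v ω η) = ω := by
  funext i
  by_cases hi : i ≤ j
  · simp [unspliceW, hi, splice]
  · simp only [unspliceW, if_neg hi, splice, show ¬ i + (m + 1) ≤ j by omega,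
      show ¬ i + (m + 1) ≤ j + 1 + m by omega, if_false]
    congr 1; omega

/-- `unspliceP` inverts the splice on pieces (copy of the planar file's plumbing). [folklore] -/
private theorem unspliceP_splice' {j : ℕ} (hη : η ∈ sawFun d m w) : unspliceP j m (splice j m v ω η) = η := by
  obtain ⟨h0, hend, -, -⟩ := mem_sawFun.1 hη
  funext i
  simp only [unspliceP, splice, show ¬ j + 1 + min i m ≤ j by omega, show j + 1 + min i m ≤ j + 1 + m by omega,
    show ¬ j + 1 ≤ j by omega, show j + 1 ≤ j + 1 + m by omega, if_false, if_true, Nat.sub_self, h0, add_zero,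
    show j + 1 + min i m - (j + 1) = min i m by omega, add_sub_cancel_left]
  rcases le_or_gt i m with h | h
  · rw [min_eq_left h]
  · rw [min_eq_right h.le, hend i h.le, hend m le_rfl]

open Classical in
/-- **(core class of all `n`-step walks) × (pieces) injects into the `(n+m+1)`-step walks.**
[cite: MadrasSlade1993, Lemma 7.3.3 (proof: "No two ω's can give rise to the same ω*")] -/
theorem card_core_saws_mul_le (hs : s = 1 ∨ s = -1) (n m j : ℕ) (k : Fin d) (w : Site d) :
    ((saws d n).filter (Core n k s w j)).card * (pieces m k s w).card ≤ count d (n + m + 1) := by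
  rw [← Finset.card_product, ← card_saws]
  refine Finset.card_le_card_of_injOn (fun p => splice j m (Pi.single k s) p.1 p.2) (fun p hp => ?_) ?_
  · rw [Finset.mem_coe, Finset.mem_product, Finset.mem_filter] at hp
    have hω : p.1 ∈ sawFun d n (p.1 n) := mem_sawFun_iff_mem_saws.2 ⟨hp.1.1, rfl⟩
    exact (mem_sawFun_iff_mem_saws.1 (splice_mem_sawFun hs hp.1.2 hω hp.2)).1
  · rintro ⟨ω₁, η₁⟩ h₁ ⟨ω₂, η₂⟩ h₂ h
    rw [Finset.mem_coe, Finset.mem_product, Finset.mem_filter] at h₁ h₂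
    have hη₁ : η₁ ∈ sawFun d m w := (mem_pieces.1 h₁.2).1
    have hη₂ : η₂ ∈ sawFun d m w := (mem_pieces.1 h₂.2).1
    have e : splice j m (Pi.single k s) ω₁ η₁ = splice j m (Pi.single k s) ω₂ η₂ := h
    have hω : ω₁ = ω₂ := by
      rw [← unspliceW_splice' (j := j) (m := m) (v := Pi.single k s) (ω := ω₁) (η := η₁), e, unspliceW_splice']
    have hη : η₁ = η₂ := by
      rw [← unspliceP_splice' (j := j) (v := Pi.single k s) (ω := ω₁) hη₁, e, unspliceP_splice' hη₂]
    rw [hω, hη]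

open Classical in
/-- **(tail class of all `n`-step walks) × (pieces) injects into the `(n+m+1)`-step walks** (append).
[cite: MadrasSlade1993, Lemma 7.3.3 (proof), Corollary 3.2.6 (proof: concatenation)] -/
theorem card_tail_mul_le (hs : s = 1 ∨ s = -1) (n m : ℕ) (k : Fin d) (w : Site d) :
    ((saws d n).filter (Tail n k s)).card * (pieces m k s w).card ≤ count d (n + m + 1) := by
  rw [← Finset.card_product, ← card_saws]
  refine Finset.card_le_card_of_injOn (fun p => appendP n (Pi.single k s) p.1 p.2) (fun p hp => ?_) ?_
  · rw [Finset.mem_coe, Finset.mem_product, Finset.mem_filter] at hp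
    exact appendP_mem_saws hs hp.1.2 hp.1.1 hp.2
  · rintro ⟨ω₁, η₁⟩ h₁ ⟨ω₂, η₂⟩ h₂ h
    rw [Finset.mem_coe, Finset.mem_product, Finset.mem_filter] at h₁ h₂
    have hη₁ : η₁ ∈ sawFun d m w := (mem_pieces.1 h₁.2).1
    have hη₂ : η₂ ∈ sawFun d m w := (mem_pieces.1 h₂.2).1
    have e : appendP n (Pi.single k s) ω₁ η₁ = appendP n (Pi.single k s) ω₂ η₂ := h
    have hω₁ : ω₁ ∈ saws d n := h₁.1.1
    have hω₂ : ω₂ ∈ saws d n := h₂.1.1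
    have hω : ω₁ = ω₂ := by
      rw [← unappendW_appendP (v := Pi.single k s) (η := η₁) hω₁, e, unappendW_appendP hω₂]
    have hη : η₁ = η₂ := by
      rw [← unspliceP_appendP (n := n) (v := Pi.single k s) (ω := ω₁) hη₁, e, unspliceP_appendP hη₂]
    rw [hω, hη]

/-! ### Every walk of positive length lies in a core class or a tail class -/

/-- **Every `n`-step self-avoiding walk with `n ≥ 1` lies in a core class `Core n k s (t e_{k'}) j` (`k' ≠ k`, `1 ≤ j < n`) or in
a tail class `Tail n k s`** (the first time the walk is farthest in the direction `s e_k` of its first step).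
[cite: MadrasSlade1993, Lemma 7.3.3 (proof: "j ≠ 0 … we must have ω_i(j) = ω_i(j+1)")] -/
theorem exists_core_or_tail (hω : ω ∈ saws d n) (hn : 1 ≤ n) :
    ∃ k : Fin d, ∃ s : ℤ, (s = 1 ∨ s = -1) ∧
      (Tail n k s ω ∨ ∃ k' : Fin d, ∃ t : ℤ, ∃ j : ℕ, k' ≠ k ∧ (t = 1 ∨ t = -1) ∧ j < n ∧ Core n k s (Pi.single k' t) j ω) := by
  classical
  obtain ⟨h0, hend, hadj, hinj⟩ := mem_saws.1 hω
  -- the direction of the first step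
  obtain ⟨k, hk⟩ := (zdGraph_adj_iff _ _).1 (hadj 0 (by omega))
  rw [zero_add, h0, zero_add] at hk
  obtain ⟨s, hs, hs1⟩ : ∃ s : ℤ, (s = 1 ∨ s = -1) ∧ s * ω 1 k = 1 := by
    rcases hk with hk | hk
    · exact ⟨1, Or.inl rfl, by rw [hk]; simp⟩
    · refine ⟨-1, Or.inr rfl, ?_⟩
      have : ω 1 k = -1 := by
        have := congrArg (fun y : Site d => y k) hk
        simp only [Pi.add_apply, Pi.single_eq_same, Pi.zero_apply] at this; linarith
      rw [this]; norm_num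
  -- the directional maximum and its first attainment time `j ≥ 1`
  obtain ⟨i₁, hi₁, hmax⟩ := Finset.exists_max_image (Finset.range (n + 1)) (fun i => s * ω i k) ⟨0, by simp⟩
  set D := s * ω i₁ k with hD
  have hmax' : ∀ i ≤ n, s * ω i k ≤ D := fun i hi => hmax i (Finset.mem_range.2 (Nat.lt_succ_of_le hi))
  have hex : ∃ j, j ≤ n ∧ s * ω j k = D := ⟨i₁, Nat.le_of_lt_succ (Finset.mem_range.1 hi₁), rfl⟩
  set j := Nat.find hex with hj
  obtain ⟨hjn, hjD⟩ : j ≤ n ∧ s * ω j k = D := Nat.find_spec hex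
  have hlt : ∀ i < j, s * ω i k < D := by
    intro i hi
    have h1 := Nat.find_min hex hi
    rcases (hmax' i (by omega)).eq_or_lt with h | h
    · exact absurd ⟨by omega, h⟩ h1
    · exact h
  have hD1 : 1 ≤ D := hs1 ▸ hmax' 1 hn
  have hj0 : j ≠ 0 := by
    intro h; have := hjD; rw [h, h0] at this; simp at this; linarith
  refine ⟨k, s, hs, ?_⟩
  rcases hjn.eq_or_lt with hjn' | hjn'
  · -- the endpoint is the record: tail class
    left
    intro i hi
    rw [← hjn', hjD]; exact hmax' i hi
  · -- an interior record: core class (the step in is `s e_k`, the step out is perpendicular)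
    right
    have hprev : ω (j - 1) = ω j - Pi.single k s := by
      obtain ⟨i, hi⟩ := (zdGraph_adj_iff _ _).1 (hadj (j - 1) (by omega))
      rw [show j - 1 + 1 = j by omega] at hi
      have hltj := hlt (j - 1) (by omega)
      by_cases hik : i = k
      · subst hik
        rcases hi with hi | hi
        · have e : ω j i = ω (j - 1) i + 1 := by rw [hi]; simp
          rcases hs with rfl | rfl
          · rw [hi]; simp
          · exfalso; rw [e] at hjD; linarith
        · have e : ω (j - 1) i = ω j i + 1 := by rw [hi]; simp
          rcases hs with rfl | rfl
          · exfalso; rw [e] at hltj; linarith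
          · rw [hi, sub_eq_add_neg, ← Pi.single_neg, neg_neg]
      · exfalso
        have e : ω (j - 1) k = ω j k := by
          rcases hi with hi | hi
          · rw [hi]; simp [Ne.symm hik]
          · rw [hi]; simp [Ne.symm hik]
        rw [e] at hltj; linarith
    obtain ⟨i, hi⟩ := (zdGraph_adj_iff _ _).1 (hadj j hjn')
    have hik : i ≠ k := by
      intro hik
      subst hik
      have hnx := hmax' (j + 1) (by omega)
      rcases hi with hi | hi
      · have e : ω (j + 1) i = ω j i + 1 := by rw [hi]; simp
        rcases hs with rfl | rfl
        · rw [e] at hnx; linarith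
        · have : ω (j + 1) = ω (j - 1) := by
            rw [hi, hprev, sub_eq_add_neg, ← Pi.single_neg, neg_neg]
          have := hinj (show j + 1 ≤ n by omega) (show j - 1 ≤ n by omega) this
          omega
      · have e : ω j i = ω (j + 1) i + 1 := by rw [hi]; simp
        rcases hs with rfl | rfl
        · have : ω (j + 1) = ω (j - 1) := by
            rw [hprev, eq_sub_iff_add_eq, ← hi]
          have := hinj (show j + 1 ≤ n by omega) (show j - 1 ≤ n by omega) this
          omega
        · linarith
    rcases hi with hi | hi
    · refine ⟨i, 1, j, hik, Or.inl rfl, hjn', hjn', fun i' hi' => ?_, hi⟩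
      rw [hjD]; exact hmax' i' hi'
    · refine ⟨i, -1, j, hik, Or.inr rfl, hjn', hjn', fun i' hi' => ?_, ?_⟩
      · rw [hjD]; exact hmax' i' hi'
      · rw [hi, add_assoc, ← Pi.single_add]; simp

/-! ### The insertion-or-append inequality for all walks -/

/-- The orientations `(k, s, k', t)`, `k' ≠ k`. [folklore] -/
private def orientsA (d : ℕ) : Finset ((Fin d × ℤ) × (Fin d × ℤ)) :=
  (((Finset.univ : Finset (Fin d)) ×ˢ ({1, -1} : Finset ℤ)) ×ˢ ((Finset.univ : Finset (Fin d)) ×ˢ ({1, -1} : Finset ℤ))).filter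
    fun o => o.2.1 ≠ o.1.1

/-- There are at most `4 d²` orientations. [folklore] -/
private theorem card_orientsA_le (d : ℕ) : (orientsA d).card ≤ 4 * d ^ 2 := by
  rw [orientsA]
  refine (Finset.card_filter_le _ _).trans ?_
  have h2 : ({1, -1} : Finset ℤ).card = 2 := by simp
  simp only [Finset.card_product, Finset.card_univ, Fintype.card_fin, h2]
  nlinarith

/-- The directions `(k, s)`. [folklore] -/
private def dirsA (d : ℕ) : Finset (Fin d × ℤ) := (Finset.univ : Finset (Fin d)) ×ˢ ({1, -1} : Finset ℤ)

/-- There are `2d` directions. [folklore] -/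
private theorem card_dirsA (d : ℕ) : (dirsA d).card = 2 * d := by
  have h2 : ({1, -1} : Finset ℤ).card = 2 := by simp
  rw [dirsA, Finset.card_product, Finset.card_univ, Fintype.card_fin, h2]; ring

open Classical in
/-- **The insertion-or-append inequality for all walks.** If `d ≥ 2` and every piece family `pieces m k s (t e_{k'})`
(`k' ≠ k`, signs `s, t`) has at least `L` members, then `c_n · L ≤ (4 d² n + 2 d) · c_{n+m+1}` for every `n ≥ 1`.
[cite: MadrasSlade1993, §7.5, eq. (7.5.1) (the super-multiplicative input at a short length); Lemma 7.3.3 (proof)] -/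
theorem count_mul_le {n m L : ℕ} (hn : 1 ≤ n) (hd : ∀ k : Fin d, ∃ k' : Fin d, k' ≠ k)
    (hL : ∀ (k : Fin d) (s : ℤ) (k' : Fin d) (t : ℤ), k' ≠ k → (s = 1 ∨ s = -1) → (t = 1 ∨ t = -1) →
      L ≤ (pieces m k s (Pi.single k' t)).card) :
    count d n * L ≤ (4 * d ^ 2 * n + 2 * d) * count d (n + m + 1) := by
  set C : (Fin d × ℤ) × (Fin d × ℤ) → ℕ → Finset (ℕ → Site d) :=
    fun o j => (saws d n).filter (Core n o.1.1 o.1.2 (Pi.single o.2.1 o.2.2) j) with hC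
  set T : Fin d × ℤ → Finset (ℕ → Site d) := fun p => (saws d n).filter (Tail n p.1 p.2) with hT
  have hcover : saws d n ⊆ ((orientsA d).biUnion fun o => (Finset.range n).biUnion fun j => C o j) ∪
      (dirsA d).biUnion fun p => T p := by
    intro ω hω
    obtain ⟨k, s, hs, h⟩ := exists_core_or_tail hω hn
    rw [Finset.mem_union]
    rcases h with h | ⟨k', t, j, hk', ht, hj, hcore⟩
    · right
      rw [Finset.mem_biUnion]
      refine ⟨(k, s), ?_, Finset.mem_filter.2 ⟨hω, h⟩⟩
      rw [dirsA, Finset.mem_product]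
      exact ⟨Finset.mem_univ _, by rcases hs with rfl | rfl <;> simp⟩
    · left
      rw [Finset.mem_biUnion]
      refine ⟨((k, s), (k', t)), ?_, ?_⟩
      · rw [orientsA, Finset.mem_filter, Finset.mem_product, Finset.mem_product, Finset.mem_product]
        refine ⟨⟨⟨Finset.mem_univ _, ?_⟩, Finset.mem_univ _, ?_⟩, hk'⟩
        · rcases hs with rfl | rfl <;> simp
        · rcases ht with rfl | rfl <;> simp
      · rw [Finset.mem_biUnion]
        exact ⟨j, Finset.mem_range.2 hj, Finset.mem_filter.2 ⟨hω, hcore⟩⟩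
  have hmemO : ∀ o ∈ orientsA d, (o.1.2 = 1 ∨ o.1.2 = -1) ∧ o.2.1 ≠ o.1.1 ∧ (o.2.2 = 1 ∨ o.2.2 = -1) := by
    intro o ho
    rw [orientsA, Finset.mem_filter, Finset.mem_product, Finset.mem_product, Finset.mem_product] at ho
    obtain ⟨⟨⟨-, h1⟩, -, h2⟩, h3⟩ := ho
    simp only [Finset.mem_insert, Finset.mem_singleton] at h1 h2
    exact ⟨h1, h3, h2⟩
  have hmemD : ∀ p ∈ dirsA d, p.2 = 1 ∨ p.2 = -1 := by
    intro p hp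
    rw [dirsA, Finset.mem_product] at hp
    simpa only [Finset.mem_insert, Finset.mem_singleton] using hp.2
  have h1 : count d n ≤ (∑ o ∈ orientsA d, ∑ j ∈ Finset.range n, (C o j).card) + ∑ p ∈ dirsA d, (T p).card := by
    rw [← card_saws]
    refine (Finset.card_le_card hcover).trans ((Finset.card_union_le _ _).trans (Nat.add_le_add ?_ ?_))
    · exact Finset.card_biUnion_le.trans (Finset.sum_le_sum fun o _ => Finset.card_biUnion_le)
    · exact Finset.card_biUnion_le
  have h2 : ∀ o ∈ orientsA d, ∀ j ∈ Finset.range n, (C o j).card * L ≤ count d (n + m + 1) := by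
    intro o ho j _
    obtain ⟨hs, hk', ht⟩ := hmemO o ho
    calc (C o j).card * L ≤ (C o j).card * (pieces m o.1.1 o.1.2 (Pi.single o.2.1 o.2.2)).card :=
          Nat.mul_le_mul_left _ (hL o.1.1 o.1.2 o.2.1 o.2.2 hk' hs ht)
      _ ≤ count d (n + m + 1) := card_core_saws_mul_le hs n m j o.1.1 _
  have h3 : ∀ p ∈ dirsA d, (T p).card * L ≤ count d (n + m + 1) := by
    intro p hp
    have hs := hmemD p hp
    obtain ⟨k', hk'⟩ := hd p.1
    calc (T p).card * L ≤ (T p).card * (pieces m p.1 p.2 (Pi.single k' 1)).card :=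
          Nat.mul_le_mul_left _ (hL p.1 p.2 k' 1 hk' hs (Or.inl rfl))
      _ ≤ count d (n + m + 1) := card_tail_mul_le hs n m p.1 _
  calc count d n * L
      ≤ ((∑ o ∈ orientsA d, ∑ j ∈ Finset.range n, (C o j).card) + ∑ p ∈ dirsA d, (T p).card) * L :=
        Nat.mul_le_mul_right _ h1
    _ = (∑ o ∈ orientsA d, ∑ j ∈ Finset.range n, (C o j).card * L) + ∑ p ∈ dirsA d, (T p).card * L := by
        rw [add_mul, Finset.sum_mul, Finset.sum_mul]
        congr 1
        exact Finset.sum_congr rfl fun o _ => by rw [Finset.sum_mul]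
    _ ≤ (∑ o ∈ orientsA d, ∑ j ∈ Finset.range n, count d (n + m + 1)) + ∑ p ∈ dirsA d, count d (n + m + 1) :=
        Nat.add_le_add (Finset.sum_le_sum fun o ho => Finset.sum_le_sum fun j hj => h2 o ho j hj)
          (Finset.sum_le_sum fun p hp => h3 p hp)
    _ = ((orientsA d).card * n + (dirsA d).card) * count d (n + m + 1) := by
        rw [Finset.sum_const, Finset.sum_const, Finset.sum_const, Finset.card_range, smul_eq_mul, smul_eq_mul,
          smul_eq_mul]; ring
    _ ≤ (4 * d ^ 2 * n + 2 * d) * count d (n + m + 1) := by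
        apply Nat.mul_le_mul_right
        have := card_orientsA_le d
        rw [card_dirsA]
        nlinarith

end PieceInsertionZd

end Literature.Probability.RandomPlanarGeometry.SAW.Zd
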